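/-
Origin: expansion seat `planner-pub-hodgecm-pv07-0`, handover 2026-08-18T03:57:51Z (`HOME/pub-hodgecm-pv07/lean/Pv07/SmokeCompact.lean`, md5 f3403773, 100 lines);
landed by the gen-5 packager in gate run 20 as `HodgeCM/PerL34/LocalFactors/SmokeCompact.lean` (import ^import Pv07\.LocalFactors\b→import HodgeCM.PerL34.LocalFactors ×1).
-/
/-
Copyright: HodgeCM publication cell (pub-hodgecm), DAG node N31f (prover pv07).
Released under the package licence.

# N31f — NON-VACUITY SMOKE TEST of the compact-place core (tex ll. 612–617)

`HodgeCM.PerL34.N31f_core_compact` quantifies over a compact abelian group with a Haar probability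
measure, a Hilbert space with a unitary strongly continuous action and a continuous unitary
character.  Here it is INSTANTIATED at the intended archimedean object: `G = U(1) = Circle`
(`= U(W_{i,b})(ℝ)` at a real place `b`, tex l. 613), `μ` = the Haar measure of `Circle` normalised
to total mass `1`, `E = ℂ` (a weight line of the Fock model), `χ = (u ↦ u)` the tautological
character and `ρ(u) = ū · id` (so that the line IS `χ̄`-isotypic: "U(W_{i,b}) acts there by
`u^{-e} = χ̄'_b(u)`", l. 616, with `e = 1`).  Conclusion: `I(1) = ‖1‖² > 0`.
Mathlib fixes no σ-algebra on `Circle`; the statement carries `[MeasurableSpace Circle]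
[BorelSpace Circle]` and `borel_circle_exists` inhabits them.  Not an input of anything.
-/
import Summits.HodgeConjecture.HodgeCM.PerL34.LocalFactors

/-! PORT of `HodgeCM/PerL34/LocalFactors/SmokeCompact.lean` (HodgeCMPerL run 82) — verbatim mechanical port; provenance in the PORT header line. -/

namespace HodgeCM
namespace PerL34
namespace LocalFactors
namespace Smoke

open MeasureTheory TopologicalSpace
open scoped InnerProductSpace ComplexConjugate

/-- The two instance binders below are inhabited: the Borel σ-algebra of `Circle`. -/
theorem borel_circle_exists : ∃ m : MeasurableSpace Circle, @BorelSpace Circle _ m :=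
  ⟨borel _, @BorelSpace.mk Circle _ (borel _) rfl⟩

/-- The scalar action `ρ(u) = conj (χ u) · id` of a unitary character on the line `ℂ`
("acts there by `χ̄'_b(u)`", tex l. 616). -/
noncomputable def scalarRep (χ : Circle →* ℂ) : Circle →* (ℂ →L[ℂ] ℂ) where
  toFun u := conj (χ u) • (1 : ℂ →L[ℂ] ℂ)
  map_one' := by simp
  map_mul' u v := by
    rw [map_mul, map_mul, smul_mul_smul_comm, one_mul]

/-- (Ported verbatim from the HodgeCMPerL package; no docstring in the source.) -/
@[simp] theorem scalarRep_apply (χ : Circle →* ℂ) (u : Circle) (z : ℂ) :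
    scalarRep χ u z = conj (χ u) * z := by
  simp [scalarRep]

/-- The tautological character `u ↦ u` of `U(1)`. -/
noncomputable def tautChar : Circle →* ℂ := Circle.coeHom

/-- (Ported verbatim from the HodgeCMPerL package; no docstring in the source.) -/
@[simp] theorem tautChar_apply (u : Circle) : tautChar u = (u : ℂ) := rfl

/-- (Ported verbatim from the HodgeCMPerL package; no docstring in the source.) -/
theorem tautChar_norm (u : Circle) : ‖tautChar u‖ = 1 := by simp

/-- (Ported verbatim from the HodgeCMPerL package; no docstring in the source.) -/
theorem tautChar_continuous : Continuous tautChar := continuous_subtype_val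

/-- (Ported verbatim from the HodgeCMPerL package; no docstring in the source.) -/
theorem scalarRep_unitary (χ : Circle →* ℂ) (hχ : ∀ u, ‖χ u‖ = 1) (u : Circle) (v w : ℂ) :
    ⟪scalarRep χ u v, scalarRep χ u w⟫_ℂ = ⟪v, w⟫_ℂ := by
  rw [scalarRep_apply, scalarRep_apply, ← smul_eq_mul, ← smul_eq_mul, inner_smul_left,
    inner_smul_right, ← mul_assoc, Complex.conj_conj, Complex.mul_conj, Complex.normSq_eq_norm_sq,
    hχ u]
  simp

/-- (Ported verbatim from the HodgeCMPerL package; no docstring in the source.) -/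
theorem scalarRep_continuous (χ : Circle →* ℂ) (hχ : Continuous χ) (v : ℂ) :
    Continuous fun u : Circle => scalarRep χ u v := by
  simp only [scalarRep_apply]
  exact (Complex.continuous_conj.comp hχ).mul continuous_const

/-- `1 ∈ ℂ` is `χ̄`-isotypic for `ρ = scalarRep χ` (by construction). -/
theorem one_isIsotypic (χ : Circle →* ℂ) : IsIsotypic (scalarRep χ) χ (1 : ℂ) := by
  intro u
  rw [scalarRep_apply, smul_eq_mul]

variable [MeasurableSpace Circle] [BorelSpace Circle]

/-- `Circle` as a positive compact (it is compact with non-empty interior `= univ`). -/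
noncomputable def circleTop : PositiveCompacts Circle :=
  ⟨⟨Set.univ, isCompact_univ⟩, by simp⟩

/-- The Haar measure of `U(1)` normalised to total mass `1` ("`du`", tex l. 266 / l. 609). -/
noncomputable def haarU1 : Measure Circle := Measure.haarMeasure circleTop

/-- (Ported verbatim from the HodgeCMPerL package; no docstring in the source.) -/
instance haarU1_isHaar : (haarU1 : Measure Circle).IsHaarMeasure := by
  unfold haarU1; infer_instance

/-- (Ported verbatim from the HodgeCMPerL package; no docstring in the source.) -/
instance haarU1_prob : IsProbabilityMeasure (haarU1 : Measure Circle) := by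
  refine ⟨?_⟩
  have h := Measure.haarMeasure_self (G := Circle) (K₀ := circleTop)
  simpa [haarU1, circleTop] using h

/-- **Smoke instance of N31f (compact place).**  At `G = U(1)`, Haar probability measure, `E = ℂ`,
`ρ = ū·id`, `χ = (u ↦ u)`: the local factor of the vector `1` is `‖1‖² = 1`, in particular its
real part is `> 0` — every hypothesis of `N31f_core_compact` discharged by Mathlib. -/
theorem N31f_compact_smoke :
    localFactor haarU1 (scalarRep tautChar) tautChar (1 : ℂ) = ((‖(1 : ℂ)‖ ^ 2 : ℝ) : ℂ) ∧
    0 < (localFactor haarU1 (scalarRep tautChar) tautChar (1 : ℂ)).re := by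
  obtain ⟨-, -, -, h4, h5⟩ := N31f_core_compact_holds Circle haarU1 ℂ (scalarRep tautChar) tautChar
    tautChar_continuous tautChar_norm (scalarRep_unitary tautChar tautChar_norm)
    (scalarRep_continuous tautChar tautChar_continuous)
  exact ⟨h4 1 (one_isIsotypic tautChar), h5 1 (one_isIsotypic tautChar) one_ne_zero⟩

end Smoke
end LocalFactors
end PerL34
end HodgeCM
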